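import Summits.BirchSwinnertonDyer.BirchSwinnertonDyer.Theorems.ResidualThetaTransportAtTwoThetaLayerLambdaCongruenceAtTwoHeckeAdjointKanPlusOfBz
import HarnessLib

/-!
# Routes `ResidualThetaTransportAtTwo` / `ThetaPartnerAtTwo`: the alias input item stmt-BirchSwinnertonDyer-27800 `HeckeSelfDualTorsionJ0Input`
# — PROVED (the Literature fact `heckeSelfDual_torsionBy_J0` is a kernel theorem via IP, `heckeSelfDual_torsionBy_J0_of_flagSides`)

Cell `bsd-wall`, width seat `bsd-wall-rtt-p3-w3` g11. THEOREMS ONLY; BSD is not proved by this; Kan⁺ (item 20688) is not settled by this.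
[cite: DarmonDiamondTaylor1995, §1.6 Lemma 1.38 and §4.5] [cite: Merel1995Homologie, §1.2–1.3 and §2.1–2.3]
-/

set_option autoImplicit false

noncomputable section

-- justification: the `Summit.BirchSwinnertonDyer.BirchSwinnertonDyer.…` path repeats a component (route-file convention)
set_option linter.dupNamespace false

namespace Summit.BirchSwinnertonDyer.BirchSwinnertonDyer.Theorems

/-- **Item stmt-BirchSwinnertonDyer-27800 `HeckeSelfDualTorsionJ0Input` holds** — the route declaration, by name (it unfolds to
`Literature.NumberTheory.EllipticCurves.ModularForms.heckeSelfDual_torsionBy_J0`). [cite: DarmonDiamondTaylor1995, §1.6 Lemma 1.38 and §4.5] -/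
theorem HeckeSelfDualTorsionJ0Input_proof :
    Summit.BirchSwinnertonDyer.BirchSwinnertonDyer.Theses.ResidualThetaTransportAtTwo.HeckeSelfDualTorsionJ0Input :=
  ThetaLayerLambdaCongruenceAtTwo.heckeSelfDual_torsionBy_J0_of_flagSides

end Summit.BirchSwinnertonDyer.BirchSwinnertonDyer.Theorems

end
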